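import Summits.QuantumFields.BalabanUV.Gaps.D1SymmetryPencil
import Summits.QuantumFields.BalabanUV.Gaps.D1WardPinsTableLine
import Summits.QuantumFields.BalabanUV.Gaps.D1RecordWardPinsBorderWeight

/-!
# `BalabanUV.Gaps.D1BorderPencilSymmetry` — cell pub-balaban-gaps, row (D1), seat g1-p1: THE END's SYMMETRY BINDERS ON THE BORDER PENCILS OF THE TWO LITERALS — at each level the
# border weights admitting the printed Ward identity (5.9) (resp. the reflection covariance (5.7)) are NONE, ONE, or ALL; uniqueness needs only that the UNIT BORDER TOWER ITSELF is not
# transversal (resp. covariant) — no moments, no summability; existence, both binders at once, and `hW` at every level for ONE border weight are BORDER-WEIGHT-FREE systems of 2×2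
# minors of Ward ∕ reflection DEFECTS; the unit border tower is TABLE-FREE, so `hW` at one level acts on the JOINT (border weight, table line) plane and pins BOTH coordinates under a
# nonzero 2×2 determinant of defects

HONEST FRAMING (cell rule, page 1 of everything): [folklore] linear algebra BY NAME — `Gaps/D1SymmetryPencil` (generic pencils; the two bookkeeping defs `wardDefect`, `reflDefect`) over GEN 15's
ENTRYWISE affinity of the step kernels in the border weight (`D1WardPinsBorderWeight.flipK_TbalOf_JsBalAn1_border_affine` for the β-lead's pinned family `JsBalAn1(r; c⃗; cE₂; cB; T)`,
`D1RecordWardPinsBorderWeight.flipK_TbalOf_JsB12CombShSym_border_affine` for the b2b wall's (III′) literal), GEN 10's table-line affinity (through `D1WardPinsTableLine.flipK_TbalOf_JsBalAn1_table_affine`)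
and GEN 12's response tower (`D1PinnedResponseTowers.T2Of_dataDiff_zero ∕ _succ`, `TbalOf_JsBalAn1_dataDiff`).  The printed (5.9) ∕ (5.7) [Balaban1987RG1 p. 293] are PREDICATES on the cells' OWN
literals; this file records what they do to the literals' free border weight `cB` (and table coordinate), AS ALGEBRA.  The located float readings quoted in docstrings (Engine C,
`ttrl/balaban-calc/gaps/PARITY-T5.md` §6: at level 0 on the p = 3 torus the (III′) literal's unit border word `U` has forward Ward divergence 3.6e−8 … 2.4e−7 on max|U| = 3.3e−7 — NOT
transversal —, the member `cB = 0` 4.8e−3 … 3.2e−2, the record `cB = −3¹²∕4` ≤ 2.7e−13) have zero classification weight and are NOT hypotheses of any theorem; they are the intended instances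
of the displayed hypotheses.  Nothing of Bałaban's asserted; NO coefficient computed or signed; (P6) untouched; (D1) NOT discharged; 0∕4 row-D1 binders; NOT `BetaPertH`, NOT continuum, NOT Clay.
HONEST DEPENDENCY (b2b cell, verbatim): «continuum YM on T⁴ ⇐ BetaPertH ∧ nine spine estimates (0/9 proved); BetaPertH ⇐ (D1) ∧ (D4) ∧ CAP+tail; G-an2-4 gates asym, D1 and NE2/3/4.»

CONTENT (all [folklore]; no `def`, 0 sorry): §1 THE β-LEAD's PINNED FAMILY (`1 ≤ Lc`, any box root, colour triple, `cE₂`, table, level): **`ward_borderPencil_trichotomy`**, `ward_borderPencil_all_of_pair`,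
**`borderWeight_unique_of_ward_of_not_wardTransversal_unitBorder`**, **`borderWeight_eq_wardDefect_ratio`** (`cB = −wardDefect (flipK T_j(0)) ν₀ z₀ ∕ wardDefect (U_j) ν₀ z₀` at ANY single entry),
**`exists_borderWeight_ward_iff_minors`** (the border-weight-FREE content of `hW` at one level), `refl_borderPencil_trichotomy`, `borderWeight_unique_of_hR_of_not_covariant_unitBorder`,
`borderWeight_eq_reflDefect_ratio`, the HIERARCHY OF HANDLES (`not_wardTransversal_of_zerothMoment_ne_zero`, `not_axisReflectionCovariant_of_firstMoment_ne_zero`: GEN 15's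
`borderWeight_unique_of_ward ∕ _of_hR` re-derived as corollaries `borderWeight_unique_of_ward_of_zerothMoment ∕ _of_hR_of_firstMoment`), **`exists_borderWeight_ward_refl_iff`** (both binders for ONE `cB` ⟺ Ward minors ∧ Ward–reflection cross minors), **`exists_borderWeight_ward_allLevels_iff`**
(the END's `hW : ∀ j, …` for ONE `cB` ⟺ cross-level minors); §2 the unit border tower is TABLE-FREE (`T2Of_unitBorder_table_free`, **`unitBorder_table_free`**), the JOINT (border weight, table line)
pencil **`flipK_TbalOf_JsBalAn1_border_table_affine`** (`flipK T_j(c⃗; cB; (1−s)T₀ + sT₁) = flipK T_j(c⃗; 0; T₀) + cB·U_j + s·V_j`, NO cross term), **`borderWeight_tableLine_unique_of_ward`** (`hW` at ONE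
level pins BOTH `cB` and `s` under a nonzero 2×2 determinant of the Ward defects of `U_j`, `V_j`), `borderWeight_tableLine_line_of_ward` (dependent defects: only `cB + κ·s`); §3 THE (III′) LITERAL
`JsB12CombShSym hLc N tabs cΛ cB` over EVERY record: `ward_recordPencil_trichotomy`, **`record_borderWeight_unique_of_not_wardTransversal_unitBorder`** (PARITY-T5 §6's located instance),
`record_borderWeight_eq_wardDefect_ratio`, `exists_record_borderWeight_ward_iff_minors`, `exists_record_borderWeight_ward_refl_iff`, `exists_record_borderWeight_ward_allLevels_iff`.

Provenance: cell pub-balaban-gaps, seat g1-p1 GEN 16 (prover-pub-balaban-gaps-g1-p1-g16-0), 2026-08-25; imports `Gaps/D1SymmetryPencil` (this seat, filed first) + `Gaps/D1WardPinsTableLine`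
(p394491 ✓) + `Gaps/D1RecordWardPinsBorderWeight` (p394966 ✓); no existing file touched.
-/

noncomputable section

open Literature.MathematicalPhysics.QuantumFieldTheory Balaban1983to89 Balaban1983to89.Beta Filter Topology
open ExpKernelCalculus (MKer tadpole)
open OneStepResolventKernel (Fib JetData)
open OneStepKernelFamily (KInvStep TbalOf flipK)
open PolarizationSign (WardTransversal AxisReflectionCovariant MomentSummable tsum_eq_zero_of_ward)
open OddMoments (zerothMoment firstMoment firstMoment_eq_zero_of_reflectionCovariant)
open SecondOrderResponse (LocStencilFM)
open BalabanCompositeJets (LocStencil₂)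
open BalabanStepW2 (T2Of)
open AffineAveraging (box toSite)
open AveragingMixedJetTables (vh₂SAt mixFFAt)
open AxialDressing (axDressK)
open Summit.QuantumFields.BalabanUV.Beta.GAN24.T2RecursionAffine (vsym)
open Summit.QuantumFields.BalabanUV.Beta.SymmetrisedStepJets (SymTables)
open Summit.QuantumFields.BalabanUV.Beta.MixedJetTablesPlug (JsBalAn1 hB_an1 hmix_an1)
open Summit.QuantumFields.BalabanUV.Beta.CombChartJointEnd (JsB12CombShSym)
open Summit.QuantumFields.BalabanUV.Gaps.D1PinnedResponseTowers (T2Of_dataDiff_zero T2Of_dataDiff_succ TbalOf_JsBalAn1_dataDiff)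
open Summit.QuantumFields.BalabanUV.Gaps.D1WardPinsBorderWeight (flipK_TbalOf_JsBalAn1_border_affine momentSummable_unitBorder)
open Summit.QuantumFields.BalabanUV.Gaps.D1WardPinsTableLine (flipK_TbalOf_JsBalAn1_table_affine)
open Summit.QuantumFields.BalabanUV.Gaps.D1RecordWardPinsBorderWeight (flipK_TbalOf_JsB12CombShSym_border_affine)
open Summit.QuantumFields.BalabanUV.Gaps.D1SymmetryPencil

namespace Summit.QuantumFields.BalabanUV.Gaps.D1BorderPencilSymmetry

/-! ## §1 The β-lead's pinned family `JsBalAn1(r; c⃗; cE₂; cB; T)`: the border pencil -/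

section Pinned

variable {Lc : ℕ} [NeZero Lc] {r : Fin (3 + 1) → ℕ}

/-- [folklore] **WARD TRICHOTOMY ON THE BORDER PENCIL** (every root, colour triple, `cE₂`, table, level): the border weights whose member has the printed Ward identity (5.9) at level `j` are
NONE, exactly ONE, or ALL. -/
theorem ward_borderPencil_trichotomy (hLc : 1 ≤ Lc) (hr : r ∈ box (3 + 1) Lc) (cE cVH cΛ cE₂ : ℝ) (T : Fin 4 → Fin 4 → Fin 4 → Fin 4 → ℝ) (j : ℕ) :
    (∀ cB cB' : ℝ, WardTransversal (flipK (TbalOf Lc (JsBalAn1 hLc hr cE cVH cΛ cE₂ cB T) j)) → WardTransversal (flipK (TbalOf Lc (JsBalAn1 hLc hr cE cVH cΛ cE₂ cB' T) j)) → cB = cB') ∨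
      ∀ cB : ℝ, WardTransversal (flipK (TbalOf Lc (JsBalAn1 hLc hr cE cVH cΛ cE₂ cB T) j)) :=
  ward_pencil_trichotomy (P := fun c => flipK (TbalOf Lc (JsBalAn1 hLc hr cE cVH cΛ cE₂ c T) j)) fun c a b z => flipK_TbalOf_JsBalAn1_border_affine hLc hr cE cVH cΛ cE₂ c T j a b z

/-- [folklore] «ALL» means the unit border tower itself is Ward-transversal at that level: two different Ward-compatible border weights ⟹ `WardTransversal (flipK T_j(1) − flipK T_j(0))` and `hW` at
level `j` for EVERY border weight. -/
theorem ward_borderPencil_all_of_pair (hLc : 1 ≤ Lc) (hr : r ∈ box (3 + 1) Lc) (cE cVH cΛ cE₂ : ℝ) (T : Fin 4 → Fin 4 → Fin 4 → Fin 4 → ℝ) (j : ℕ) {cB cB' : ℝ}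
    (hW : WardTransversal (flipK (TbalOf Lc (JsBalAn1 hLc hr cE cVH cΛ cE₂ cB T) j))) (hW' : WardTransversal (flipK (TbalOf Lc (JsBalAn1 hLc hr cE cVH cΛ cE₂ cB' T) j)))
    (hne : cB ≠ cB') :
    WardTransversal (fun a b w => flipK (TbalOf Lc (JsBalAn1 hLc hr cE cVH cΛ cE₂ 1 T) j) a b w - flipK (TbalOf Lc (JsBalAn1 hLc hr cE cVH cΛ cE₂ 0 T) j) a b w) ∧
      ∀ cB'' : ℝ, WardTransversal (flipK (TbalOf Lc (JsBalAn1 hLc hr cE cVH cΛ cE₂ cB'' T) j)) :=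
  ward_pencil_all_of_pair (P := fun c => flipK (TbalOf Lc (JsBalAn1 hLc hr cE cVH cΛ cE₂ c T) j)) (fun c a b z => flipK_TbalOf_JsBalAn1_border_affine hLc hr cE cVH cΛ cE₂ c T j a b z)
    hW hW' hne

/-- [folklore] **WARD PINS THE BORDER WEIGHT — FROM THE UNIT BORDER TOWER's OWN NON-TRANSVERSALITY** (no moments, no summability; sharper than GEN 15's `borderWeight_unique_of_ward`, whose handle
was a nonzero zeroth moment): if at level `j` the unit border tower `flipK T_j(1) − flipK T_j(0)` is NOT Ward-transversal (Engine C's located reading for the record twin at level 0, PARITY-T5 §6: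
divergence 3.6e−8 … 2.4e−7 on max 3.3e−7; zero weight), then AT MOST ONE border weight per `(r; c⃗; cE₂; T)` admits `hW` at level `j`. -/
theorem borderWeight_unique_of_ward_of_not_wardTransversal_unitBorder (hLc : 1 ≤ Lc) (hr : r ∈ box (3 + 1) Lc) (cE cVH cΛ cE₂ : ℝ) (T : Fin 4 → Fin 4 → Fin 4 → Fin 4 → ℝ) (j : ℕ)
    (hU : ¬ WardTransversal (fun a b w => flipK (TbalOf Lc (JsBalAn1 hLc hr cE cVH cΛ cE₂ 1 T) j) a b w - flipK (TbalOf Lc (JsBalAn1 hLc hr cE cVH cΛ cE₂ 0 T) j) a b w)) {cB cB' : ℝ}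
    (hW : WardTransversal (flipK (TbalOf Lc (JsBalAn1 hLc hr cE cVH cΛ cE₂ cB T) j))) (hW' : WardTransversal (flipK (TbalOf Lc (JsBalAn1 hLc hr cE cVH cΛ cE₂ cB' T) j))) : cB = cB' :=
  ward_pencil_unique (P := fun c => flipK (TbalOf Lc (JsBalAn1 hLc hr cE cVH cΛ cE₂ c T) j)) (fun c a b z => flipK_TbalOf_JsBalAn1_border_affine hLc hr cE cVH cΛ cE₂ c T j a b z) hU hW hW'

/-- [folklore] … and it is the ratio of Ward DEFECTS at ANY single entry `(ν₀, z₀)` where the unit border tower's defect is nonzero: `cB = −wardDefect (flipK T_j(0)) ν₀ z₀ ∕ wardDefect (U_j) ν₀ z₀`. -/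
theorem borderWeight_eq_wardDefect_ratio (hLc : 1 ≤ Lc) (hr : r ∈ box (3 + 1) Lc) (cE cVH cΛ cE₂ : ℝ) (T : Fin 4 → Fin 4 → Fin 4 → Fin 4 → ℝ) (j : ℕ) {ν₀ : Fin 4} {z₀ : Fin 4 → ℤ}
    (hU : wardDefect (fun a b w => flipK (TbalOf Lc (JsBalAn1 hLc hr cE cVH cΛ cE₂ 1 T) j) a b w - flipK (TbalOf Lc (JsBalAn1 hLc hr cE cVH cΛ cE₂ 0 T) j) a b w) ν₀ z₀ ≠ 0) {cB : ℝ}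
    (hW : WardTransversal (flipK (TbalOf Lc (JsBalAn1 hLc hr cE cVH cΛ cE₂ cB T) j))) :
    cB = -wardDefect (flipK (TbalOf Lc (JsBalAn1 hLc hr cE cVH cΛ cE₂ 0 T) j)) ν₀ z₀ /
      wardDefect (fun a b w => flipK (TbalOf Lc (JsBalAn1 hLc hr cE cVH cΛ cE₂ 1 T) j) a b w - flipK (TbalOf Lc (JsBalAn1 hLc hr cE cVH cΛ cE₂ 0 T) j) a b w) ν₀ z₀ :=
  ward_pencil_formula (P := fun c => flipK (TbalOf Lc (JsBalAn1 hLc hr cE cVH cΛ cE₂ c T) j)) (fun c a b z => flipK_TbalOf_JsBalAn1_border_affine hLc hr cE cVH cΛ cE₂ c T j a b z) hU hW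

/-- [folklore] **THE BORDER-WEIGHT-FREE CONTENT OF `hW` AT ONE LEVEL**: given one entry where the unit border tower's Ward defect is nonzero, SOME border weight admits `hW` at level `j` iff
the Ward defects of the member `cB = 0` and of the unit border tower are PROPORTIONAL (all minors against the pivot vanish) — a condition on (root, colour triple, `cE₂`, table) alone. -/
theorem exists_borderWeight_ward_iff_minors (hLc : 1 ≤ Lc) (hr : r ∈ box (3 + 1) Lc) (cE cVH cΛ cE₂ : ℝ) (T : Fin 4 → Fin 4 → Fin 4 → Fin 4 → ℝ) (j : ℕ) {ν₀ : Fin 4} {z₀ : Fin 4 → ℤ}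
    (hU : wardDefect (fun a b w => flipK (TbalOf Lc (JsBalAn1 hLc hr cE cVH cΛ cE₂ 1 T) j) a b w - flipK (TbalOf Lc (JsBalAn1 hLc hr cE cVH cΛ cE₂ 0 T) j) a b w) ν₀ z₀ ≠ 0) :
    (∃ cB : ℝ, WardTransversal (flipK (TbalOf Lc (JsBalAn1 hLc hr cE cVH cΛ cE₂ cB T) j))) ↔
      ∀ ν z, wardDefect (flipK (TbalOf Lc (JsBalAn1 hLc hr cE cVH cΛ cE₂ 0 T) j)) ν z *
          wardDefect (fun a b w => flipK (TbalOf Lc (JsBalAn1 hLc hr cE cVH cΛ cE₂ 1 T) j) a b w - flipK (TbalOf Lc (JsBalAn1 hLc hr cE cVH cΛ cE₂ 0 T) j) a b w) ν₀ z₀ =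
        wardDefect (flipK (TbalOf Lc (JsBalAn1 hLc hr cE cVH cΛ cE₂ 0 T) j)) ν₀ z₀ *
          wardDefect (fun a b w => flipK (TbalOf Lc (JsBalAn1 hLc hr cE cVH cΛ cE₂ 1 T) j) a b w - flipK (TbalOf Lc (JsBalAn1 hLc hr cE cVH cΛ cE₂ 0 T) j) a b w) ν z :=
  ward_pencil_exists_iff (P := fun c => flipK (TbalOf Lc (JsBalAn1 hLc hr cE cVH cΛ cE₂ c T) j)) (fun c a b z => flipK_TbalOf_JsBalAn1_border_affine hLc hr cE cVH cΛ cE₂ c T j a b z) hU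

/-- [folklore] REFLECTION TRICHOTOMY ON THE BORDER PENCIL: the border weights admitting the printed reflection covariance (5.7) at level `j` are none, one, or all. -/
theorem refl_borderPencil_trichotomy (hLc : 1 ≤ Lc) (hr : r ∈ box (3 + 1) Lc) (cE cVH cΛ cE₂ : ℝ) (T : Fin 4 → Fin 4 → Fin 4 → Fin 4 → ℝ) (j : ℕ) :
    (∀ cB cB' : ℝ, AxisReflectionCovariant (flipK (TbalOf Lc (JsBalAn1 hLc hr cE cVH cΛ cE₂ cB T) j)) →
        AxisReflectionCovariant (flipK (TbalOf Lc (JsBalAn1 hLc hr cE cVH cΛ cE₂ cB' T) j)) → cB = cB') ∨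
      ∀ cB : ℝ, AxisReflectionCovariant (flipK (TbalOf Lc (JsBalAn1 hLc hr cE cVH cΛ cE₂ cB T) j)) :=
  refl_pencil_trichotomy (P := fun c => flipK (TbalOf Lc (JsBalAn1 hLc hr cE cVH cΛ cE₂ c T) j)) fun c a b z => flipK_TbalOf_JsBalAn1_border_affine hLc hr cE cVH cΛ cE₂ c T j a b z

/-- [folklore] **REFLECTION PINS THE BORDER WEIGHT FROM THE UNIT BORDER TOWER's OWN NON-COVARIANCE**: `¬ AxisReflectionCovariant (U_j)` ⟹ at most one border weight admits `hR` at level `j`. -/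
theorem borderWeight_unique_of_hR_of_not_covariant_unitBorder (hLc : 1 ≤ Lc) (hr : r ∈ box (3 + 1) Lc) (cE cVH cΛ cE₂ : ℝ) (T : Fin 4 → Fin 4 → Fin 4 → Fin 4 → ℝ) (j : ℕ)
    (hU : ¬ AxisReflectionCovariant (fun a b w => flipK (TbalOf Lc (JsBalAn1 hLc hr cE cVH cΛ cE₂ 1 T) j) a b w - flipK (TbalOf Lc (JsBalAn1 hLc hr cE cVH cΛ cE₂ 0 T) j) a b w))
    {cB cB' : ℝ} (hR : AxisReflectionCovariant (flipK (TbalOf Lc (JsBalAn1 hLc hr cE cVH cΛ cE₂ cB T) j)))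
    (hR' : AxisReflectionCovariant (flipK (TbalOf Lc (JsBalAn1 hLc hr cE cVH cΛ cE₂ cB' T) j))) : cB = cB' :=
  refl_pencil_unique (P := fun c => flipK (TbalOf Lc (JsBalAn1 hLc hr cE cVH cΛ cE₂ c T) j)) (fun c a b z => flipK_TbalOf_JsBalAn1_border_affine hLc hr cE cVH cΛ cE₂ c T j a b z) hU hR hR'

/-- [folklore] … with the explicit ratio of reflection defects at any entry where the unit border tower's is nonzero. -/
theorem borderWeight_eq_reflDefect_ratio (hLc : 1 ≤ Lc) (hr : r ∈ box (3 + 1) Lc) (cE cVH cΛ cE₂ : ℝ) (T : Fin 4 → Fin 4 → Fin 4 → Fin 4 → ℝ) (j : ℕ) {α₀ μ₀ ν₀ : Fin 4}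
    {z₀ : Fin 4 → ℤ}
    (hU : reflDefect (fun a b w => flipK (TbalOf Lc (JsBalAn1 hLc hr cE cVH cΛ cE₂ 1 T) j) a b w - flipK (TbalOf Lc (JsBalAn1 hLc hr cE cVH cΛ cE₂ 0 T) j) a b w) α₀ μ₀ ν₀ z₀ ≠ 0)
    {cB : ℝ} (hR : AxisReflectionCovariant (flipK (TbalOf Lc (JsBalAn1 hLc hr cE cVH cΛ cE₂ cB T) j))) :
    cB = -reflDefect (flipK (TbalOf Lc (JsBalAn1 hLc hr cE cVH cΛ cE₂ 0 T) j)) α₀ μ₀ ν₀ z₀ /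
      reflDefect (fun a b w => flipK (TbalOf Lc (JsBalAn1 hLc hr cE cVH cΛ cE₂ 1 T) j) a b w - flipK (TbalOf Lc (JsBalAn1 hLc hr cE cVH cΛ cE₂ 0 T) j) a b w) α₀ μ₀ ν₀ z₀ :=
  refl_pencil_formula (P := fun c => flipK (TbalOf Lc (JsBalAn1 hLc hr cE cVH cΛ cE₂ c T) j)) (fun c a b z => flipK_TbalOf_JsBalAn1_border_affine hLc hr cE cVH cΛ cE₂ c T j a b z) hU hR

/-- [folklore] HIERARCHY OF HANDLES: a nonzero zeroth moment (given summable moments) is a nonzero Ward defect somewhere — an1's `tsum_eq_zero_of_ward`, contraposed. -/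
theorem not_wardTransversal_of_zerothMoment_ne_zero {d : ℕ} {P : B12Beta.Kernel d} (hP : MomentSummable P 3) {c e : Fin d} (h : zerothMoment P c e ≠ 0) :
    ¬ WardTransversal P := fun hW => h (tsum_eq_zero_of_ward hP hW c e)

/-- [folklore] … and a nonzero first moment is a nonzero reflection defect somewhere (an1's `firstMoment_eq_zero_of_reflectionCovariant`, contraposed; no summability). -/
theorem not_axisReflectionCovariant_of_firstMoment_ne_zero {d : ℕ} {P : B12Beta.Kernel d} {c e γ : Fin d} (h : firstMoment P c e γ ≠ 0) : ¬ AxisReflectionCovariant P :=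
  fun hR => h (firstMoment_eq_zero_of_reflectionCovariant hR c e γ)

/-- [folklore] GEN 15's `D1WardPinsBorderWeight.borderWeight_unique_of_ward` RE-DERIVED as the corollary of the defect handle (a nonzero unit-border zeroth moment ⟹ the unit border tower is not
Ward-transversal ⟹ at most one Ward-compatible border weight). -/
theorem borderWeight_unique_of_ward_of_zerothMoment (hLc : 1 ≤ Lc) (hr : r ∈ box (3 + 1) Lc) (cE cVH cΛ cE₂ : ℝ) (T : Fin 4 → Fin 4 → Fin 4 → Fin 4 → ℝ) (j : ℕ) {c e : Fin 4}
    (hU : zerothMoment (fun a b w => flipK (TbalOf Lc (JsBalAn1 hLc hr cE cVH cΛ cE₂ 1 T) j) a b w - flipK (TbalOf Lc (JsBalAn1 hLc hr cE cVH cΛ cE₂ 0 T) j) a b w) c e ≠ 0) {cB cB' : ℝ}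
    (hW : WardTransversal (flipK (TbalOf Lc (JsBalAn1 hLc hr cE cVH cΛ cE₂ cB T) j))) (hW' : WardTransversal (flipK (TbalOf Lc (JsBalAn1 hLc hr cE cVH cΛ cE₂ cB' T) j))) : cB = cB' :=
  borderWeight_unique_of_ward_of_not_wardTransversal_unitBorder hLc hr cE cVH cΛ cE₂ T j
    (not_wardTransversal_of_zerothMoment_ne_zero (momentSummable_unitBorder hLc hr cE cVH cΛ cE₂ T j 3) hU) hW hW'

/-- [folklore] GEN 15's `borderWeight_unique_of_hR` RE-DERIVED the same way (a nonzero unit-border first moment ⟹ not reflection-covariant ⟹ at most one `hR`-compatible border weight). -/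
theorem borderWeight_unique_of_hR_of_firstMoment (hLc : 1 ≤ Lc) (hr : r ∈ box (3 + 1) Lc) (cE cVH cΛ cE₂ : ℝ) (T : Fin 4 → Fin 4 → Fin 4 → Fin 4 → ℝ) (j : ℕ) {c e γ : Fin 4}
    (hU : firstMoment (fun a b w => flipK (TbalOf Lc (JsBalAn1 hLc hr cE cVH cΛ cE₂ 1 T) j) a b w - flipK (TbalOf Lc (JsBalAn1 hLc hr cE cVH cΛ cE₂ 0 T) j) a b w) c e γ ≠ 0) {cB cB' : ℝ}
    (hR : AxisReflectionCovariant (flipK (TbalOf Lc (JsBalAn1 hLc hr cE cVH cΛ cE₂ cB T) j)))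
    (hR' : AxisReflectionCovariant (flipK (TbalOf Lc (JsBalAn1 hLc hr cE cVH cΛ cE₂ cB' T) j))) : cB = cB' :=
  borderWeight_unique_of_hR_of_not_covariant_unitBorder hLc hr cE cVH cΛ cE₂ T j (not_axisReflectionCovariant_of_firstMoment_ne_zero hU) hR hR'

/-- [folklore] **BOTH SYMMETRY BINDERS AT ONE LEVEL FOR ONE BORDER WEIGHT ⟺ border-weight-FREE minors**: given one entry where the unit border tower's Ward defect is nonzero, SOME `cB`
admits `hW` ∧ `hR` at level `j` iff (i) the Ward defects of the member `cB = 0` and of the unit border tower are proportional AND (ii) the reflection defects are proportional to them WITH THE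
SAME RATIO (cross minors) — conditions on (root, colour triple, `cE₂`, table) alone. -/
theorem exists_borderWeight_ward_refl_iff (hLc : 1 ≤ Lc) (hr : r ∈ box (3 + 1) Lc) (cE cVH cΛ cE₂ : ℝ) (T : Fin 4 → Fin 4 → Fin 4 → Fin 4 → ℝ) (j : ℕ) {ν₀ : Fin 4} {z₀ : Fin 4 → ℤ}
    (hU : wardDefect (fun a b w => flipK (TbalOf Lc (JsBalAn1 hLc hr cE cVH cΛ cE₂ 1 T) j) a b w - flipK (TbalOf Lc (JsBalAn1 hLc hr cE cVH cΛ cE₂ 0 T) j) a b w) ν₀ z₀ ≠ 0) :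
    (∃ cB : ℝ, WardTransversal (flipK (TbalOf Lc (JsBalAn1 hLc hr cE cVH cΛ cE₂ cB T) j)) ∧ AxisReflectionCovariant (flipK (TbalOf Lc (JsBalAn1 hLc hr cE cVH cΛ cE₂ cB T) j))) ↔
      (∀ ν z, wardDefect (flipK (TbalOf Lc (JsBalAn1 hLc hr cE cVH cΛ cE₂ 0 T) j)) ν z *
            wardDefect (fun a b w => flipK (TbalOf Lc (JsBalAn1 hLc hr cE cVH cΛ cE₂ 1 T) j) a b w - flipK (TbalOf Lc (JsBalAn1 hLc hr cE cVH cΛ cE₂ 0 T) j) a b w) ν₀ z₀ =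
          wardDefect (flipK (TbalOf Lc (JsBalAn1 hLc hr cE cVH cΛ cE₂ 0 T) j)) ν₀ z₀ *
            wardDefect (fun a b w => flipK (TbalOf Lc (JsBalAn1 hLc hr cE cVH cΛ cE₂ 1 T) j) a b w - flipK (TbalOf Lc (JsBalAn1 hLc hr cE cVH cΛ cE₂ 0 T) j) a b w) ν z) ∧
        ∀ α μ ν z, reflDefect (flipK (TbalOf Lc (JsBalAn1 hLc hr cE cVH cΛ cE₂ 0 T) j)) α μ ν z *
            wardDefect (fun a b w => flipK (TbalOf Lc (JsBalAn1 hLc hr cE cVH cΛ cE₂ 1 T) j) a b w - flipK (TbalOf Lc (JsBalAn1 hLc hr cE cVH cΛ cE₂ 0 T) j) a b w) ν₀ z₀ =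
          wardDefect (flipK (TbalOf Lc (JsBalAn1 hLc hr cE cVH cΛ cE₂ 0 T) j)) ν₀ z₀ *
            reflDefect (fun a b w => flipK (TbalOf Lc (JsBalAn1 hLc hr cE cVH cΛ cE₂ 1 T) j) a b w - flipK (TbalOf Lc (JsBalAn1 hLc hr cE cVH cΛ cE₂ 0 T) j) a b w) α μ ν z :=
  ward_refl_pencil_exists_iff (P := fun c => flipK (TbalOf Lc (JsBalAn1 hLc hr cE cVH cΛ cE₂ c T) j)) (fun c a b z => flipK_TbalOf_JsBalAn1_border_affine hLc hr cE cVH cΛ cE₂ c T j a b z) hU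

/-- [folklore] **`hW` AT EVERY LEVEL FOR ONE BORDER WEIGHT ⟺ CROSS-LEVEL MINORS** (what the END's binder `hW : ∀ j, WardTransversal (flipK (TbalOf … j))` demands of (root, colour triple, `cE₂`,
table) once a single entry `(j₀, ν₀, z₀)` with nonzero unit-border Ward defect is known): `∃ cB, ∀ j, hW_j(cB)` iff for all `j, ν, z`
`wardDefect (flipK T_j(0)) ν z · wardDefect (U_{j₀}) ν₀ z₀ = wardDefect (flipK T_{j₀}(0)) ν₀ z₀ · wardDefect (U_j) ν z`. -/
theorem exists_borderWeight_ward_allLevels_iff (hLc : 1 ≤ Lc) (hr : r ∈ box (3 + 1) Lc) (cE cVH cΛ cE₂ : ℝ) (T : Fin 4 → Fin 4 → Fin 4 → Fin 4 → ℝ) {j₀ : ℕ} {ν₀ : Fin 4} {z₀ : Fin 4 → ℤ}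
    (hU : wardDefect (fun a b w => flipK (TbalOf Lc (JsBalAn1 hLc hr cE cVH cΛ cE₂ 1 T) j₀) a b w - flipK (TbalOf Lc (JsBalAn1 hLc hr cE cVH cΛ cE₂ 0 T) j₀) a b w) ν₀ z₀ ≠ 0) :
    (∃ cB : ℝ, ∀ j, WardTransversal (flipK (TbalOf Lc (JsBalAn1 hLc hr cE cVH cΛ cE₂ cB T) j))) ↔
      ∀ j ν z, wardDefect (flipK (TbalOf Lc (JsBalAn1 hLc hr cE cVH cΛ cE₂ 0 T) j)) ν z *
          wardDefect (fun a b w => flipK (TbalOf Lc (JsBalAn1 hLc hr cE cVH cΛ cE₂ 1 T) j₀) a b w - flipK (TbalOf Lc (JsBalAn1 hLc hr cE cVH cΛ cE₂ 0 T) j₀) a b w) ν₀ z₀ =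
        wardDefect (flipK (TbalOf Lc (JsBalAn1 hLc hr cE cVH cΛ cE₂ 0 T) j₀)) ν₀ z₀ *
          wardDefect (fun a b w => flipK (TbalOf Lc (JsBalAn1 hLc hr cE cVH cΛ cE₂ 1 T) j) a b w - flipK (TbalOf Lc (JsBalAn1 hLc hr cE cVH cΛ cE₂ 0 T) j) a b w) ν z :=
  ward_levels_exists_iff (P := fun j c => flipK (TbalOf Lc (JsBalAn1 hLc hr cE cVH cΛ cE₂ c T) j))
    (U := fun j => fun a b w => flipK (TbalOf Lc (JsBalAn1 hLc hr cE cVH cΛ cE₂ 1 T) j) a b w - flipK (TbalOf Lc (JsBalAn1 hLc hr cE cVH cΛ cE₂ 0 T) j) a b w)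
    (fun j c a b z => flipK_TbalOf_JsBalAn1_border_affine hLc hr cE cVH cΛ cE₂ c T j a b z) hU

/-! ## §2 The unit border tower is TABLE-FREE; the joint (border weight, table line) pencil -/

/-- [folklore] **an2's UNIT BORDER TOWER DOES NOT SEE THE POSITION TABLE** (certified border ∕ mixed tables, any colour triple, any `cE₂`, every level): `T2Of(c⃗; 1, T) j − T2Of(c⃗; 0, T) j =
T2Of(c⃗; 1, T′) j − T2Of(c⃗; 0, T′) j` — the response tower of GEN 12 with source `mfNeg ∘ B` and NO table source (`T2Of_dataDiff_zero ∕ _succ`). -/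
theorem T2Of_unitBorder_table_free {d : ℕ} (hLc : 1 ≤ Lc) (cE cVH cΛ cE₂ : ℝ) (T T' : Fin 4 → Fin 4 → Fin 4 → Fin 4 → ℝ)
    {B : Fin (d + 1) → (Fin (d + 1) → ℤ) → Fin (d + 1) → (Fin (d + 1) → ℤ) → MKer (d + 1) (Fib d)}
    {mixFF : Fin (d + 1) → (Fin (d + 1) → ℤ) → Fin (d + 1) → (Fin (d + 1) → ℤ) → MKer (d + 1) (Fib d)}
    (hB : ∃ C δ : ℝ, 0 < δ ∧ LocStencil₂ B C δ) (hmix : ∃ C δ : ℝ, 0 < δ ∧ LocStencilFM Lc mixFF C δ) :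
    ∀ j : ℕ, T2Of d Lc cE cVH cΛ cE₂ 1 T B mixFF j - T2Of d Lc cE cVH cΛ cE₂ 0 T B mixFF j = T2Of d Lc cE cVH cΛ cE₂ 1 T' B mixFF j - T2Of d Lc cE cVH cΛ cE₂ 0 T' B mixFF j
  | 0 => by
    funext κ u κ' u'
    simp only [Pi.sub_apply]
    rw [T2Of_dataDiff_zero, T2Of_dataDiff_zero]
    simp only [sub_self]
  | j + 1 => by
    have IH := T2Of_unitBorder_table_free hLc cE cVH cΛ cE₂ T T' hB hmix j
    funext κ u κ' u'
    simp only [Pi.sub_apply]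
    rw [T2Of_dataDiff_succ cE cVH cΛ cE₂ 1 0 T T hLc hB hmix j, T2Of_dataDiff_succ cE cVH cΛ cE₂ 1 0 T' T' hLc hB hmix j, IH]

/-- [folklore] **THE PINNED FAMILY's UNIT BORDER TOWER IS TABLE-FREE, ENTRYWISE**: `T_j(c⃗; 1; T) − T_j(c⃗; 0; T) = T_j(c⃗; 1; T′) − T_j(c⃗; 0; T′)` (GEN 12's `TbalOf_JsBalAn1_dataDiff` + the above at
an1's certified tables).  With GEN 15's `unitBorder_colour_free`: ONE kernel per (root, `cE₂`, level) for the whole (colour, table) space. -/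
theorem unitBorder_table_free (hLc : 1 ≤ Lc) (hr : r ∈ box (3 + 1) Lc) (cE cVH cΛ cE₂ : ℝ) (T T' : Fin 4 → Fin 4 → Fin 4 → Fin 4 → ℝ) (j : ℕ) (μ ν : Fin 4) (z : Fin 4 → ℤ) :
    TbalOf Lc (JsBalAn1 hLc hr cE cVH cΛ cE₂ 1 T) j μ ν z - TbalOf Lc (JsBalAn1 hLc hr cE cVH cΛ cE₂ 0 T) j μ ν z =
      TbalOf Lc (JsBalAn1 hLc hr cE cVH cΛ cE₂ 1 T') j μ ν z - TbalOf Lc (JsBalAn1 hLc hr cE cVH cΛ cE₂ 0 T') j μ ν z := by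
  rw [TbalOf_JsBalAn1_dataDiff hLc hr cE cVH cΛ cE₂ 1 0 T T j μ ν z, TbalOf_JsBalAn1_dataDiff hLc hr cE cVH cΛ cE₂ 1 0 T' T' j μ ν z,
    T2Of_unitBorder_table_free (d := 3) hLc cE cVH cΛ cE₂ T T' (hB_an1 hLc hr) (hmix_an1 hLc hr) j]

/-- [folklore] **THE JOINT (BORDER WEIGHT, TABLE LINE) PENCIL, ENTRYWISE**: along a line of position tables `T_s := (1−s)T₀ + sT₁`,
`flipK T_j(c⃗; cB; T_s) = flipK T_j(c⃗; 0; T₀) + cB·U_j + s·V_j` with `U_j := flipK T_j(c⃗; 1; T₀) − flipK T_j(c⃗; 0; T₀)` (the unit border tower) and `V_j := flipK T_j(c⃗; 0; T₁) − flipK T_j(c⃗; 0; T₀)`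
(the unit table tower of the line) — NO cross term (border-affinity at `T_s`, table-freeness of `U_j`, table-affinity at `cB = 0`). -/
theorem flipK_TbalOf_JsBalAn1_border_table_affine (hLc : 1 ≤ Lc) (hr : r ∈ box (3 + 1) Lc) (cE cVH cΛ cE₂ : ℝ) (T₀ T₁ : Fin 4 → Fin 4 → Fin 4 → Fin 4 → ℝ) (j : ℕ) (cB s : ℝ)
    (a b : Fin 4) (w : Fin 4 → ℤ) :
    flipK (TbalOf Lc (JsBalAn1 hLc hr cE cVH cΛ cE₂ cB ((1 - s) • T₀ + s • T₁)) j) a b w =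
      flipK (TbalOf Lc (JsBalAn1 hLc hr cE cVH cΛ cE₂ 0 ((1 - (0:ℝ)) • T₀ + (0:ℝ) • T₁)) j) a b w +
        cB * (fun a' b' w' => flipK (TbalOf Lc (JsBalAn1 hLc hr cE cVH cΛ cE₂ 1 T₀) j) a' b' w' - flipK (TbalOf Lc (JsBalAn1 hLc hr cE cVH cΛ cE₂ 0 T₀) j) a' b' w') a b w +
        s * (fun a' b' w' => flipK (TbalOf Lc (JsBalAn1 hLc hr cE cVH cΛ cE₂ 0 T₁) j) a' b' w' - flipK (TbalOf Lc (JsBalAn1 hLc hr cE cVH cΛ cE₂ 0 T₀) j) a' b' w') a b w := by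
  have h0 : (1 - (0:ℝ)) • T₀ + (0:ℝ) • T₁ = T₀ := by rw [sub_zero, one_smul, zero_smul, add_zero]
  rw [h0, flipK_TbalOf_JsBalAn1_border_affine hLc hr cE cVH cΛ cE₂ cB ((1 - s) • T₀ + s • T₁) j a b w,
    flipK_TbalOf_JsBalAn1_table_affine hLc hr cE cVH cΛ cE₂ 0 T₀ T₁ s j a b w]
  simp only [OneStepKernelFamily.flipK_apply]
  rw [unitBorder_table_free hLc hr cE cVH cΛ cE₂ ((1 - s) • T₀ + s • T₁) T₀ j a b (-w)]
  ring

/-- [folklore] **`hW` AT ONE LEVEL PINS THE BORDER WEIGHT AND THE TABLE COORDINATE TOGETHER** when the Ward defects of the unit border tower `U_j` and of the line's unit table tower `V_j` have a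
nonzero 2×2 determinant at two entries: at most ONE `(cB, s)` per (root, colour triple, `cE₂`, line, level). -/
theorem borderWeight_tableLine_unique_of_ward (hLc : 1 ≤ Lc) (hr : r ∈ box (3 + 1) Lc) (cE cVH cΛ cE₂ : ℝ) (T₀ T₁ : Fin 4 → Fin 4 → Fin 4 → Fin 4 → ℝ) (j : ℕ) {ν₁ : Fin 4}
    {z₁ : Fin 4 → ℤ} {ν₂ : Fin 4} {z₂ : Fin 4 → ℤ}
    (hdet : wardDefect (fun a b w => flipK (TbalOf Lc (JsBalAn1 hLc hr cE cVH cΛ cE₂ 1 T₀) j) a b w - flipK (TbalOf Lc (JsBalAn1 hLc hr cE cVH cΛ cE₂ 0 T₀) j) a b w) ν₁ z₁ *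
          wardDefect (fun a b w => flipK (TbalOf Lc (JsBalAn1 hLc hr cE cVH cΛ cE₂ 0 T₁) j) a b w - flipK (TbalOf Lc (JsBalAn1 hLc hr cE cVH cΛ cE₂ 0 T₀) j) a b w) ν₂ z₂ -
        wardDefect (fun a b w => flipK (TbalOf Lc (JsBalAn1 hLc hr cE cVH cΛ cE₂ 1 T₀) j) a b w - flipK (TbalOf Lc (JsBalAn1 hLc hr cE cVH cΛ cE₂ 0 T₀) j) a b w) ν₂ z₂ *
          wardDefect (fun a b w => flipK (TbalOf Lc (JsBalAn1 hLc hr cE cVH cΛ cE₂ 0 T₁) j) a b w - flipK (TbalOf Lc (JsBalAn1 hLc hr cE cVH cΛ cE₂ 0 T₀) j) a b w) ν₁ z₁ ≠ 0)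
    {cB s cB' s' : ℝ} (hW : WardTransversal (flipK (TbalOf Lc (JsBalAn1 hLc hr cE cVH cΛ cE₂ cB ((1 - s) • T₀ + s • T₁)) j)))
    (hW' : WardTransversal (flipK (TbalOf Lc (JsBalAn1 hLc hr cE cVH cΛ cE₂ cB' ((1 - s') • T₀ + s' • T₁)) j))) : cB = cB' ∧ s = s' :=
  ward_pencil₂_unique (P := fun c t => flipK (TbalOf Lc (JsBalAn1 hLc hr cE cVH cΛ cE₂ c ((1 - t) • T₀ + t • T₁)) j))
    (fun c t a b z => flipK_TbalOf_JsBalAn1_border_table_affine hLc hr cE cVH cΛ cE₂ T₀ T₁ j c t a b z) hdet hW hW'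

/-- [folklore] … and when the two defects are PROPORTIONAL (`wardDefect V_j = κ · wardDefect U_j`) with `U_j`'s nonzero somewhere, `hW` at level `j` pins only the combination `cB + κ·s`
(a LINE of Ward-compatible (border weight, table) pairs). -/
theorem borderWeight_tableLine_line_of_ward (hLc : 1 ≤ Lc) (hr : r ∈ box (3 + 1) Lc) (cE cVH cΛ cE₂ : ℝ) (T₀ T₁ : Fin 4 → Fin 4 → Fin 4 → Fin 4 → ℝ) (j : ℕ) {κ : ℝ}
    (hκ : ∀ ν z, wardDefect (fun a b w => flipK (TbalOf Lc (JsBalAn1 hLc hr cE cVH cΛ cE₂ 0 T₁) j) a b w - flipK (TbalOf Lc (JsBalAn1 hLc hr cE cVH cΛ cE₂ 0 T₀) j) a b w) ν z =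
      κ * wardDefect (fun a b w => flipK (TbalOf Lc (JsBalAn1 hLc hr cE cVH cΛ cE₂ 1 T₀) j) a b w - flipK (TbalOf Lc (JsBalAn1 hLc hr cE cVH cΛ cE₂ 0 T₀) j) a b w) ν z)
    {ν₀ : Fin 4} {z₀ : Fin 4 → ℤ}
    (hU : wardDefect (fun a b w => flipK (TbalOf Lc (JsBalAn1 hLc hr cE cVH cΛ cE₂ 1 T₀) j) a b w - flipK (TbalOf Lc (JsBalAn1 hLc hr cE cVH cΛ cE₂ 0 T₀) j) a b w) ν₀ z₀ ≠ 0)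
    {cB s : ℝ} (hW : WardTransversal (flipK (TbalOf Lc (JsBalAn1 hLc hr cE cVH cΛ cE₂ cB ((1 - s) • T₀ + s • T₁)) j))) :
    cB + κ * s = -wardDefect (flipK (TbalOf Lc (JsBalAn1 hLc hr cE cVH cΛ cE₂ 0 T₀) j)) ν₀ z₀ /
      wardDefect (fun a b w => flipK (TbalOf Lc (JsBalAn1 hLc hr cE cVH cΛ cE₂ 1 T₀) j) a b w - flipK (TbalOf Lc (JsBalAn1 hLc hr cE cVH cΛ cE₂ 0 T₀) j) a b w) ν₀ z₀ := by
  have h := ward_pencil₂_line (P := fun c t => flipK (TbalOf Lc (JsBalAn1 hLc hr cE cVH cΛ cE₂ c ((1 - t) • T₀ + t • T₁)) j))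
    (fun c t a b z => flipK_TbalOf_JsBalAn1_border_table_affine hLc hr cE cVH cΛ cE₂ T₀ T₁ j c t a b z) hκ hU hW
  have h0 : (1 - (0:ℝ)) • T₀ + (0:ℝ) • T₁ = T₀ := by rw [sub_zero, one_smul, zero_smul, add_zero]
  simpa only [h0] using h

end Pinned

/-! ## §3 The b2b wall's (III′) literal `JsB12CombShSym hLc N tabs cΛ cB` over every table record -/

section Record

variable {Lc : ℕ} [NeZero Lc]

/-- [folklore] WARD TRICHOTOMY ON THE RECORD FAMILY's BORDER PENCIL (every record `tabs`, numeral `N`, `cΛ`, level). -/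
theorem ward_recordPencil_trichotomy (hLc : Odd Lc) (N : ℕ) (tabs : SymTables 3 Lc) (cΛ : ℝ) (j : ℕ) :
    (∀ cB cB' : ℝ, WardTransversal (flipK (TbalOf Lc (JsB12CombShSym hLc N tabs cΛ cB) j)) → WardTransversal (flipK (TbalOf Lc (JsB12CombShSym hLc N tabs cΛ cB') j)) → cB = cB') ∨
      ∀ cB : ℝ, WardTransversal (flipK (TbalOf Lc (JsB12CombShSym hLc N tabs cΛ cB) j)) :=
  ward_pencil_trichotomy (P := fun c => flipK (TbalOf Lc (JsB12CombShSym hLc N tabs cΛ c) j)) fun c a b z => flipK_TbalOf_JsB12CombShSym_border_affine hLc N tabs cΛ c j a b z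

/-- [folklore] **WARD PINS THE RECORD's BORDER WEIGHT FROM THE UNIT BORDER WORD's OWN NON-TRANSVERSALITY** — the located instance: Engine C, PARITY-T5 §6, reads for the EVALUATED record
literal at level 0 on the p = 3 torus that `U` (the unit border word) has forward Ward divergence 3.6e−8 … 2.4e−7 on max|U| = 3.3e−7 (NOT transversal), the member `cB = 0` 4.8e−3 … 3.2e−2,
the record `cB = −3¹²∕4` ≤ 2.7e−13 (zero weight; one torus, one level).  The theorem: `¬ WardTransversal (U_j)` ⟹ at most ONE `cB` admits `hW` at level `j`. -/
theorem record_borderWeight_unique_of_not_wardTransversal_unitBorder (hLc : Odd Lc) (N : ℕ) (tabs : SymTables 3 Lc) (cΛ : ℝ) (j : ℕ)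
    (hU : ¬ WardTransversal (fun a b w => flipK (TbalOf Lc (JsB12CombShSym hLc N tabs cΛ 1) j) a b w - flipK (TbalOf Lc (JsB12CombShSym hLc N tabs cΛ 0) j) a b w)) {cB cB' : ℝ}
    (hW : WardTransversal (flipK (TbalOf Lc (JsB12CombShSym hLc N tabs cΛ cB) j))) (hW' : WardTransversal (flipK (TbalOf Lc (JsB12CombShSym hLc N tabs cΛ cB') j))) : cB = cB' :=
  ward_pencil_unique (P := fun c => flipK (TbalOf Lc (JsB12CombShSym hLc N tabs cΛ c) j)) (fun c a b z => flipK_TbalOf_JsB12CombShSym_border_affine hLc N tabs cΛ c j a b z) hU hW hW'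

/-- [folklore] … as the ratio of Ward defects at any single entry where the unit border word's defect is nonzero. -/
theorem record_borderWeight_eq_wardDefect_ratio (hLc : Odd Lc) (N : ℕ) (tabs : SymTables 3 Lc) (cΛ : ℝ) (j : ℕ) {ν₀ : Fin 4} {z₀ : Fin 4 → ℤ}
    (hU : wardDefect (fun a b w => flipK (TbalOf Lc (JsB12CombShSym hLc N tabs cΛ 1) j) a b w - flipK (TbalOf Lc (JsB12CombShSym hLc N tabs cΛ 0) j) a b w) ν₀ z₀ ≠ 0) {cB : ℝ}
    (hW : WardTransversal (flipK (TbalOf Lc (JsB12CombShSym hLc N tabs cΛ cB) j))) :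
    cB = -wardDefect (flipK (TbalOf Lc (JsB12CombShSym hLc N tabs cΛ 0) j)) ν₀ z₀ /
      wardDefect (fun a b w => flipK (TbalOf Lc (JsB12CombShSym hLc N tabs cΛ 1) j) a b w - flipK (TbalOf Lc (JsB12CombShSym hLc N tabs cΛ 0) j) a b w) ν₀ z₀ :=
  ward_pencil_formula (P := fun c => flipK (TbalOf Lc (JsB12CombShSym hLc N tabs cΛ c) j)) (fun c a b z => flipK_TbalOf_JsB12CombShSym_border_affine hLc N tabs cΛ c j a b z) hU hW

/-- [folklore] **THE BORDER-WEIGHT-FREE CONTENT OF `hW` AT ONE LEVEL FOR THE RECORD FAMILY**: solvability in `cB` ⟺ proportional Ward defects (minors against a pivot). -/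
theorem exists_record_borderWeight_ward_iff_minors (hLc : Odd Lc) (N : ℕ) (tabs : SymTables 3 Lc) (cΛ : ℝ) (j : ℕ) {ν₀ : Fin 4} {z₀ : Fin 4 → ℤ}
    (hU : wardDefect (fun a b w => flipK (TbalOf Lc (JsB12CombShSym hLc N tabs cΛ 1) j) a b w - flipK (TbalOf Lc (JsB12CombShSym hLc N tabs cΛ 0) j) a b w) ν₀ z₀ ≠ 0) :
    (∃ cB : ℝ, WardTransversal (flipK (TbalOf Lc (JsB12CombShSym hLc N tabs cΛ cB) j))) ↔
      ∀ ν z, wardDefect (flipK (TbalOf Lc (JsB12CombShSym hLc N tabs cΛ 0) j)) ν z *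
          wardDefect (fun a b w => flipK (TbalOf Lc (JsB12CombShSym hLc N tabs cΛ 1) j) a b w - flipK (TbalOf Lc (JsB12CombShSym hLc N tabs cΛ 0) j) a b w) ν₀ z₀ =
        wardDefect (flipK (TbalOf Lc (JsB12CombShSym hLc N tabs cΛ 0) j)) ν₀ z₀ *
          wardDefect (fun a b w => flipK (TbalOf Lc (JsB12CombShSym hLc N tabs cΛ 1) j) a b w - flipK (TbalOf Lc (JsB12CombShSym hLc N tabs cΛ 0) j) a b w) ν z :=
  ward_pencil_exists_iff (P := fun c => flipK (TbalOf Lc (JsB12CombShSym hLc N tabs cΛ c) j)) (fun c a b z => flipK_TbalOf_JsB12CombShSym_border_affine hLc N tabs cΛ c j a b z) hU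

/-- [folklore] BOTH SYMMETRY BINDERS AT ONE LEVEL FOR ONE BORDER WEIGHT OF THE RECORD FAMILY ⟺ Ward minors ∧ Ward–reflection cross minors (border-weight-free). -/
theorem exists_record_borderWeight_ward_refl_iff (hLc : Odd Lc) (N : ℕ) (tabs : SymTables 3 Lc) (cΛ : ℝ) (j : ℕ) {ν₀ : Fin 4} {z₀ : Fin 4 → ℤ}
    (hU : wardDefect (fun a b w => flipK (TbalOf Lc (JsB12CombShSym hLc N tabs cΛ 1) j) a b w - flipK (TbalOf Lc (JsB12CombShSym hLc N tabs cΛ 0) j) a b w) ν₀ z₀ ≠ 0) :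
    (∃ cB : ℝ, WardTransversal (flipK (TbalOf Lc (JsB12CombShSym hLc N tabs cΛ cB) j)) ∧ AxisReflectionCovariant (flipK (TbalOf Lc (JsB12CombShSym hLc N tabs cΛ cB) j))) ↔
      (∀ ν z, wardDefect (flipK (TbalOf Lc (JsB12CombShSym hLc N tabs cΛ 0) j)) ν z *
            wardDefect (fun a b w => flipK (TbalOf Lc (JsB12CombShSym hLc N tabs cΛ 1) j) a b w - flipK (TbalOf Lc (JsB12CombShSym hLc N tabs cΛ 0) j) a b w) ν₀ z₀ =
          wardDefect (flipK (TbalOf Lc (JsB12CombShSym hLc N tabs cΛ 0) j)) ν₀ z₀ *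
            wardDefect (fun a b w => flipK (TbalOf Lc (JsB12CombShSym hLc N tabs cΛ 1) j) a b w - flipK (TbalOf Lc (JsB12CombShSym hLc N tabs cΛ 0) j) a b w) ν z) ∧
        ∀ α μ ν z, reflDefect (flipK (TbalOf Lc (JsB12CombShSym hLc N tabs cΛ 0) j)) α μ ν z *
            wardDefect (fun a b w => flipK (TbalOf Lc (JsB12CombShSym hLc N tabs cΛ 1) j) a b w - flipK (TbalOf Lc (JsB12CombShSym hLc N tabs cΛ 0) j) a b w) ν₀ z₀ =
          wardDefect (flipK (TbalOf Lc (JsB12CombShSym hLc N tabs cΛ 0) j)) ν₀ z₀ *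
            reflDefect (fun a b w => flipK (TbalOf Lc (JsB12CombShSym hLc N tabs cΛ 1) j) a b w - flipK (TbalOf Lc (JsB12CombShSym hLc N tabs cΛ 0) j) a b w) α μ ν z :=
  ward_refl_pencil_exists_iff (P := fun c => flipK (TbalOf Lc (JsB12CombShSym hLc N tabs cΛ c) j)) (fun c a b z => flipK_TbalOf_JsB12CombShSym_border_affine hLc N tabs cΛ c j a b z) hU

/-- [folklore] **`hW` AT EVERY LEVEL FOR ONE BORDER WEIGHT OF THE RECORD FAMILY ⟺ CROSS-LEVEL MINORS** against one pivot `(j₀, ν₀, z₀)` with nonzero unit-border Ward defect. -/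
theorem exists_record_borderWeight_ward_allLevels_iff (hLc : Odd Lc) (N : ℕ) (tabs : SymTables 3 Lc) (cΛ : ℝ) {j₀ : ℕ} {ν₀ : Fin 4} {z₀ : Fin 4 → ℤ}
    (hU : wardDefect (fun a b w => flipK (TbalOf Lc (JsB12CombShSym hLc N tabs cΛ 1) j₀) a b w - flipK (TbalOf Lc (JsB12CombShSym hLc N tabs cΛ 0) j₀) a b w) ν₀ z₀ ≠ 0) :
    (∃ cB : ℝ, ∀ j, WardTransversal (flipK (TbalOf Lc (JsB12CombShSym hLc N tabs cΛ cB) j))) ↔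
      ∀ j ν z, wardDefect (flipK (TbalOf Lc (JsB12CombShSym hLc N tabs cΛ 0) j)) ν z *
          wardDefect (fun a b w => flipK (TbalOf Lc (JsB12CombShSym hLc N tabs cΛ 1) j₀) a b w - flipK (TbalOf Lc (JsB12CombShSym hLc N tabs cΛ 0) j₀) a b w) ν₀ z₀ =
        wardDefect (flipK (TbalOf Lc (JsB12CombShSym hLc N tabs cΛ 0) j₀)) ν₀ z₀ *
          wardDefect (fun a b w => flipK (TbalOf Lc (JsB12CombShSym hLc N tabs cΛ 1) j) a b w - flipK (TbalOf Lc (JsB12CombShSym hLc N tabs cΛ 0) j) a b w) ν z :=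
  ward_levels_exists_iff (P := fun j c => flipK (TbalOf Lc (JsB12CombShSym hLc N tabs cΛ c) j))
    (U := fun j => fun a b w => flipK (TbalOf Lc (JsB12CombShSym hLc N tabs cΛ 1) j) a b w - flipK (TbalOf Lc (JsB12CombShSym hLc N tabs cΛ 0) j) a b w)
    (fun j c a b z => flipK_TbalOf_JsB12CombShSym_border_affine hLc N tabs cΛ c j a b z) hU

end Record

end Summit.QuantumFields.BalabanUV.Gaps.D1BorderPencilSymmetry

end
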